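import Summits.ResolutionOfSingularities.ResolutionOfSingularities.Theorems.HilbertSamuelEliminationSigmaMaxModificationsCorridor3TameStratumSplit
import Summits.ResolutionOfSingularities.ResolutionOfSingularities.Theorems.HilbertSamuelEliminationSigmaMaxModificationsCorridor3TameWildNuGluingFinite
import Summits.ResolutionOfSingularities.ResolutionOfSingularities.Theorems.HilbertSamuelEliminationSigmaMaxModificationsCorridor3TameWildNuModPackaging
import Summits.ResolutionOfSingularities.ResolutionOfSingularities.Theorems.HilbertSamuelEliminationSigmaMaxModificationsSurfaceNuMods
import HarnessLib

/-!
# Route `HilbertSamuelElimination`, crux `SigmaMaxModificationsCorridor3`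
# (stmt-ResolutionOfSingularities-19249; child of `SigmaMaxModifications` stmt-…-18506),
# line `tame_wild`: T-ψ + G2 — a hypersurface stratum is settled on its lower-dimensional part;
# only the purely three-dimensional part needs a witness

[OURS · L1 W4.2] The consumer form of helpers T-ψ (`…Corridor3TameStratumSplit.lean`,
p473251/p474309) and G2 (`…Corridor3TameWildNuGluing2.lean`, p479360) of `L/w42/CHAIN.md` v2 §4:
for a maximal HYPERSURFACE value `ν = hypersurfaceHFe 4 m`, `m ≥ 2` (e.g. every tame value
`hypersurfaceHF m ≠ Φ^{(3)}`), of a reduced threefold `Y/k`, the stratum `Y(ν)` splits into the clopen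
traces on the disjoint opens `U` (`dim U ≤ 2`) and `V` (purely three-dimensional); over `U` the
printed CJS `ν`-elimination of surfaces (named fact `CossartJannsenSaito2020_nuElimination`, raised
to level `3` by the landed `Sketch.stub_nuMods_surface_of_nuFact`) is a local `ν`-witness, so by the
two-chart gluing **a local `ν`-witness over `V` alone yields `NuMod Y 3 3 ν`**
(`nuMod_of_localWitness_on_top_part`). In other words: for hypersurface values the `ν`-modification
problem of the line (`stub_confinedTameNu3_of_thor4`, `stub_confinedWildNu3` at hypersurface values)
may assume `Y` purely three-dimensional along the stratum — every closed point of the relevant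
stratum has `dim 𝒪_{Y,y} = 3`, embedding dimension `4`. NOT a statement of any manuscript.

* `localWitness_of_nuMod_opens` — a `ν`-modification of an OPEN SUBSCHEME `U ⊆ X` is a local
  `ν`-witness over `U` in the sense of p459350 (`H^N_U = H^N_X|_U`, `U(ν) = U ∩ X(ν)`).
* `exists_localWitness_opens_of_dim_le_two` — modulo `CossartJannsenSaito2020_nuElimination`: a
  local `ν`-witness over every open `U` of dimension `≤ 2` (maximal `ν ≠ Φ^{(N)}`, `N ≥ 2`).
* `hypersurfaceHFe_four_ne_iterPSum` — `hypersurfaceHFe 4 m ≠ Φ^{(3)}` for `m ≥ 2`.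
* `nuMod_of_localWitness_on_top_part` — the reduction.

## Sources

* V. Cossart, U. Jannsen, S. Saito, LNM 2270 (2020), Def. 2.28, Lemma 2.36, Def. 6.14, Rem. 6.24,
  Thm. 6.28. [CossartJannsenSaito2020]
* The Stacks Project, Tags 0A21, 01LH. [StacksProject]
-/

set_option linter.dupNamespace false -- mandated namespace of this single-conjunct summit

noncomputable section

open CategoryTheory CategoryTheory.Limits AlgebraicGeometry TopologicalSpace Topology Order
open Literature.AlgebraicGeometry.Resolution Literature.RingTheory.HilbertSamuel
open Summit.ResolutionOfSingularities.ResolutionOfSingularities.Theorems.SigmaMaxModificationsCorridor3.TameWild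
open Summit.ResolutionOfSingularities.ResolutionOfSingularities.Theorems.SigmaMaxModifications.Sketch

namespace Summit.ResolutionOfSingularities.ResolutionOfSingularities.Theorems.SigmaMaxModificationsCorridor3.Helpers

/-! ## A `ν`-modification of an open subscheme is a local witness -/

/-- **A `ν`-modification of an open subscheme `U ⊆ X` is a local `ν`-witness over `U`** (the
hypothesis shape of `TameWild.nuMod_of_localWitness`, p459350), for any open `Zc ⊆ X ∖ X(ν)`: the
stratum of `U` is the trace of the stratum of `X` and `H^N_U = H^N_X|_U` (`Scheme.hsFun_opens`), dense
opens of `X` restrict to dense opens of `U`. [OURS · L1 W4.2]; NOT a statement of the manuscript.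
[cite: CossartJannsenSaito2020, Def. 2.28, Def. 6.14] -/
theorem localWitness_of_nuMod_opens (X : Scheme.{0}) [IsLocallyNoetherian X] (N d : ℕ)
    (ν : ℕ → ℕ) (Zc U : X.Opens) (hZc : (Zc : Set X) ⊆ (Scheme.hsStratum X N ν)ᶜ)
    (h : NuMod (U : Scheme.{0}) N d ν) :
    ∃ (Y : Scheme.{0}) (ρ : Y ⟶ (U : Scheme.{0})), IsProper ρ ∧ IsReduced Y ∧
      topologicalKrullDim Y ≤ (d : WithBot ℕ∞) ∧ topologicalKrullDim Y ≤ (N : WithBot ℕ∞) ∧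
      IsIso (ρ ∣_ (U.ι ⁻¹ᵁ Zc)) ∧
      (∀ V : X.Opens, Dense (V : Set X) → (V : Set X) ⊆ (Scheme.hsStratum X N ν)ᶜ →
        Dense ((ρ ⁻¹ᵁ (U.ι ⁻¹ᵁ V) : Y.Opens) : Set Y)) ∧
      (∀ y : Y, Scheme.hsFun Y N y ≤ Scheme.hsFun X N (U.ι.base (ρ.base y))) ∧
      ν ∉ Scheme.hsValues Y N := by
  obtain ⟨Y, π, hP, hred, hd, hN, hiso, hdense, hmono, hkill⟩ := h
  -- the stratum of `U` is the trace of the stratum of `X`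
  have hstr : ∀ u : (U : Scheme.{0}), u ∈ Scheme.hsStratum (U : Scheme.{0}) N ν ↔
      U.ι.base u ∈ Scheme.hsStratum X N ν := fun u => by
    rw [Scheme.mem_hsStratum_iff, Scheme.mem_hsStratum_iff, Scheme.hsFun_opens]
  have hW : ((U.ι ⁻¹ᵁ Zc : (U : Scheme.{0}).Opens) : Set (U : Scheme.{0})) ⊆
      (Scheme.hsStratum (U : Scheme.{0}) N ν)ᶜ := fun u hu hu' => hZc hu ((hstr u).mp hu')
  refine ⟨Y, π, hP, hred, hd, hN, hiso _ hW, fun V hVd hV => ?_, fun y => ?_, hkill⟩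
  · exact hdense (U.ι ⁻¹ᵁ V) (hVd.preimage U.2.isOpenMap_subtype_val)
      fun u hu hu' => hV hu ((hstr u).mp hu')
  · rw [← Scheme.hsFun_opens U N (π.base y)]
    exact hmono y

/-! ## The lower-dimensional part: a local witness from the printed surface theorem -/

/-- **A local `ν`-witness over every open of dimension `≤ 2`, modulo the printed CJS
`ν`-elimination of surfaces.** For `Y/k` reduced, separated, of finite type, `dim Y ≤ N`, `N ≥ 2`,
`ν ≠ Φ^{(N)}` maximal in `Σ_Y(N)`, an open `Zc ⊆ Y ∖ Y(ν)` and an open `U` with `dim U ≤ 2`: either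
`ν ∉ Σ_U(N)` (the identity of `U` is a witness) or `ν` is maximal in `Σ_U(N) ⊆ Σ_Y(N)` and the landed
`Sketch.stub_nuMods_surface_of_nuFact` (CJS Thm. 6.28 raised to level `N`) gives a `ν`-modification
of `U`, i.e. a local witness (`localWitness_of_nuMod_opens`). CONDITIONAL on the named fact
`CossartJannsenSaito2020_nuElimination` (print debt of the route). [OURS · L1 W4.2]; NOT a statement
of the manuscript. [cite: CossartJannsenSaito2020, Thm. 6.28, Def. 6.14, Rem. 2.29 (b)] -/
theorem exists_localWitness_opens_of_dim_le_two (hCJS : CossartJannsenSaito2020_nuElimination.{0})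
    {k : Type} [Field k] {Y : Scheme.{0}} (g : Y ⟶ Spec (.of k)) [IsSeparated g]
    [LocallyOfFiniteType g] [QuasiCompact g] [IsReduced Y] {N : ℕ} (hN : 2 ≤ N)
    (hdimN : topologicalKrullDim Y ≤ (N : WithBot ℕ∞)) {ν : ℕ → ℕ}
    (hν : Maximal (· ∈ Scheme.hsValues Y N) ν) (hνΦ : ν ≠ iterPSum N Phi)
    (Zc U : Y.Opens) (hZc : (Zc : Set Y) ⊆ (Scheme.hsStratum Y N ν)ᶜ)
    (hU : topologicalKrullDim (U : Scheme.{0}) ≤ ((2 : ℕ) : WithBot ℕ∞)) :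
    ∃ (Y₁ : Scheme.{0}) (ρ : Y₁ ⟶ (U : Scheme.{0})), IsProper ρ ∧ IsReduced Y₁ ∧
      topologicalKrullDim Y₁ ≤ ((2 : ℕ) : WithBot ℕ∞) ∧
      topologicalKrullDim Y₁ ≤ (N : WithBot ℕ∞) ∧
      IsIso (ρ ∣_ (U.ι ⁻¹ᵁ Zc)) ∧
      (∀ V : Y.Opens, Dense (V : Set Y) → (V : Set Y) ⊆ (Scheme.hsStratum Y N ν)ᶜ →
        Dense ((ρ ⁻¹ᵁ (U.ι ⁻¹ᵁ V) : Y₁.Opens) : Set Y₁)) ∧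
      (∀ y : Y₁, Scheme.hsFun Y₁ N y ≤ Scheme.hsFun Y N (U.ι.base (ρ.base y))) ∧
      ν ∉ Scheme.hsValues Y₁ N := by
  haveI : IsLocallyNoetherian Y := LocallyOfFiniteType.isLocallyNoetherian g
  haveI : IsReduced (U : Scheme.{0}) := isReduced_of_isOpenImmersion U.ι
  have hdimU : topologicalKrullDim (U : Scheme.{0}) ≤ (N : WithBot ℕ∞) :=
    U.ι.isOpenEmbedding.isInducing.topologicalKrullDim_le.trans hdimN
  refine localWitness_of_nuMod_opens Y N 2 ν Zc U hZc ?_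
  by_cases hmem : ν ∈ Scheme.hsValues (U : Scheme.{0}) N
  · -- `ν` is maximal in `Σ_U(N) ⊆ Σ_Y(N)`: the printed surface theorem applies to `U`
    have hνU : Maximal (· ∈ Scheme.hsValues (U : Scheme.{0}) N) ν :=
      ⟨hmem, fun μ hμ hνμ => hν.2 (Scheme.hsValues_subset_of_isOpenImmersion U.ι N hμ) hνμ⟩
    exact stub_nuMods_surface_of_nuFact hCJS k N hN (U : Scheme.{0}) (U.ι ≫ g) inferInstance
      inferInstance inferInstance inferInstance hU hdimU ν hνU hνΦ
  · -- `ν` is not a value of `U`: nothing to do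
    refine nuMod_of_hsStratum_eq_empty (U : Scheme.{0}) N 2 ν hU hdimU ?_
    exact Set.not_nonempty_iff_eq_empty.mp fun hne => hmem (Scheme.hsStratum_nonempty_iff.mp hne)

/-! ## The reduction to the purely three-dimensional part -/

/-- `hypersurfaceHFe 4 m ≠ Φ^{(3)}` for `m ≥ 2` (`Φ^{(3)} = hypersurfaceHFe 4 1` and the hypersurface
functions are injective in the multiplicity). [cite: CossartJannsenSaito2020, Thm. 2.3, Def. 2.28] -/
theorem hypersurfaceHFe_four_ne_iterPSum {m : ℕ} (hm : 2 ≤ m) :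
    hypersurfaceHFe 4 m ≠ iterPSum 3 Phi := by
  rw [← hypersurfaceHFe_succ_one_eq_iterPSum_Phi 3]
  intro h
  have h1 : m = 1 := hypersurfaceHFe_injective (e := 4) (by norm_num) h
  omega

/-- **T-ψ + G2: for a maximal hypersurface value, a local `ν`-witness over the purely
three-dimensional part of the stratum already gives the `ν`-modification** (modulo the printed CJS
surface theorem for the lower-dimensional part). For `Y/k` reduced, separated, of finite type,
`dim Y ≤ 3`, `ν = hypersurfaceHFe 4 m` maximal in `Σ_Y(3)`, `m ≥ 2`: there are the open
`Zc = Y ∖ Y(ν)` (the stratum of a maximal value is closed over a field) and DISJOINT opens `U`, `V`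
covering `Y(ν)` with `dim U ≤ 2` and `V` purely three-dimensional (every irreducible component through
a point of `V` has dimension `3`; at the closed points of `V ∩ Y(ν)`: `dim 𝒪_{Y,y} = 3`, embedding
dimension `4`, cf. `…Corridor3TameStratumSplit.lean`), such that EVERY local `ν`-witness over `V`
(proper, reduced of dimension `≤ 3`, isomorphism over `V ∩ Zc`, dense opens inside `Y ∖ Y(ν)` pulled
back densely, `H^3` non-increasing, `ν` not a value) yields `NuMod Y 3 3 ν` — the witness over `U`
comes from `exists_localWitness_opens_of_dim_le_two`, and the two glue by
`stub_G2_nuMod_of_two_localWitnesses` (`U ∩ V = ∅ ⊆ Zc`). [OURS · L1 W4.2] helpers T-ψ + G2 of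
CHAIN v2 assembled; CONDITIONAL on `CossartJannsenSaito2020_nuElimination`; NOT a statement of the
manuscript. [cite: CossartJannsenSaito2020, Def. 6.14, Rem. 6.24, Lemma 2.36, Thm. 6.28]
[cite: StacksProject, Tag 0A21, Tag 01LH] -/
theorem nuMod_of_localWitness_on_top_part (hCJS : CossartJannsenSaito2020_nuElimination.{0})
    {k : Type} [Field k] {Y : Scheme.{0}} (g : Y ⟶ Spec (.of k)) [IsSeparated g]
    [LocallyOfFiniteType g] [QuasiCompact g] [IsReduced Y]
    (hdim : topologicalKrullDim Y ≤ ((3 : ℕ) : WithBot ℕ∞)) {m : ℕ} (hm : 2 ≤ m)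
    (hν : Maximal (· ∈ Scheme.hsValues Y 3) (hypersurfaceHFe 4 m)) :
    ∃ Zc U V : Y.Opens, (Zc : Set Y) = (Scheme.hsStratum Y 3 (hypersurfaceHFe 4 m))ᶜ ∧
      Disjoint U V ∧
      Scheme.hsStratum Y 3 (hypersurfaceHFe 4 m) ⊆ (U : Set Y) ∪ (V : Set Y) ∧
      topologicalKrullDim (U : Scheme.{0}) ≤ ((2 : ℕ) : WithBot ℕ∞) ∧
      (∀ v ∈ (V : Set Y), ∀ η : Y, IsMax η → η ⤳ v → height η = 3) ∧
      (∀ (Y₂ : Scheme.{0}) (ρ₂ : Y₂ ⟶ (V : Scheme.{0})), IsProper ρ₂ → IsReduced Y₂ →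
        topologicalKrullDim Y₂ ≤ ((3 : ℕ) : WithBot ℕ∞) →
        IsIso (ρ₂ ∣_ (V.ι ⁻¹ᵁ Zc)) →
        (∀ W : Y.Opens, Dense (W : Set Y) →
          (W : Set Y) ⊆ (Scheme.hsStratum Y 3 (hypersurfaceHFe 4 m))ᶜ →
          Dense ((ρ₂ ⁻¹ᵁ (V.ι ⁻¹ᵁ W) : Y₂.Opens) : Set Y₂)) →
        (∀ y : Y₂, Scheme.hsFun Y₂ 3 y ≤ Scheme.hsFun Y 3 (V.ι.base (ρ₂.base y))) →
        hypersurfaceHFe 4 m ∉ Scheme.hsValues Y₂ 3 →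
        NuMod Y 3 3 (hypersurfaceHFe 4 m)) := by
  haveI : IsLocallyNoetherian Y := LocallyOfFiniteType.isLocallyNoetherian g
  set ν : ℕ → ℕ := hypersurfaceHFe 4 m with hνdef
  -- the stratum of the maximal value `ν` is closed: `Zc := Y ∖ Y(ν)`
  have husc : ∀ μ : ℕ → ℕ, IsClosed (Scheme.hsStratumGE Y 3 μ) :=
    (stub_isClosed_hsMaxLocus_over_field stub_hsFun_le_of_specializes_over_field k Y g
      inferInstance inferInstance 3 hdim).1
  have hcl : IsClosed (Scheme.hsStratum Y 3 ν) := Scheme.isClosed_hsStratum_of_maximal husc hν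
  let Zc : Y.Opens := ⟨(Scheme.hsStratum Y 3 ν)ᶜ, hcl.isOpen_compl⟩
  -- T-ψ
  obtain ⟨U, V, hUV, hcovS, hdimU, hV, -⟩ := exists_opens_split_hsStratum_hypersurfaceHFe g hdim hm
  -- the witness over the lower-dimensional part `U`
  obtain ⟨Y₁, ρ₁, hρ₁, hY₁, hd₁, hN₁, hiso₁, hdense₁, hmono₁, hkill₁⟩ :=
    exists_localWitness_opens_of_dim_le_two hCJS g (by norm_num) hdim hν
      (hypersurfaceHFe_four_ne_iterPSum hm) Zc U subset_rfl hdimU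
  refine ⟨Zc, U, V, rfl, hUV, hcovS, hdimU, hV,
    fun Y₂ ρ₂ hρ₂ hY₂ hd₂ hiso₂ hdense₂ hmono₂ hkill₂ => ?_⟩
  -- the two charts meet nowhere, in particular only inside `Zc`, and cover the stratum
  have h12 : U ⊓ V ≤ Zc := by
    rw [disjoint_iff.mp hUV]
    exact bot_le
  have hcov : Zc ⊔ (U ⊔ V) = ⊤ := by
    ext y
    simp only [Opens.coe_sup, Opens.coe_top, Set.mem_univ, iff_true]
    by_cases hy : y ∈ Scheme.hsStratum Y 3 ν
    · exact Or.inr (hcovS hy)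
    · exact Or.inl hy
  have hd₁' : topologicalKrullDim Y₁ ≤ ((3 : ℕ) : WithBot ℕ∞) :=
    hd₁.trans (by exact_mod_cast (by norm_num : (2 : ℕ) ≤ 3))
  exact stub_G2_nuMod_of_two_localWitnesses Y 3 3 ν hdim hdim Zc U V rfl hcov h12 Y₁ ρ₁ hρ₁ hY₁
    hd₁' hN₁ hiso₁ hdense₁ hmono₁ hkill₁ Y₂ ρ₂ hρ₂ hY₂ hd₂ hd₂ hiso₂ hdense₂ hmono₂ hkill₂

end Summit.ResolutionOfSingularities.ResolutionOfSingularities.Theorems.SigmaMaxModificationsCorridor3.Helpers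

end
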